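import Summits.Ventures.PercRepro.ProfileGapMonoThresholdNullityFourFibre
import Summits.Ventures.PercRepro.ProfileGapMonoThresholdNullityFourUnits
import Summits.Ventures.PercRepro.ProfileGapMonoThresholdDependentPay

/-!
# PercRepro — THE TOP THRESHOLD OF THE CO-RANK-`4` FAMILY HOLDS ON EVERY SIMPLE COLOOP-FREE MATROID OF NULLITY `4`
(p5, gen 32; `proofs/P5-GM1.md` §44(d))

`#E = ρ(E) + 4`, `N` simple (every pair has rank `2`) and coloop-free, `ρ(E) ≥ 5`, co-rank `4`, threshold
`ρ(E) − 1`.  With no `6`-point plane (else TopNuTwo) the excess form of §40(c) reads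
`Σ_L ρ(E ∖ B) ≤ Σ_L #(E ∖ cl B) + #𝔅`, `𝔅` = the deficient sets (demanding rank-`3` sets with a `5`-point plane);
the DEPENDENT ones (`≤ 2` coloops) are paid by the dependent targets (DependentPay, every nullity), the INDEPENDENT
ones (`3` coloops, hence three points) by the boundary units of the independent targets through three countings with
the uniform constant `3 (ρ(E) − 3)`: every independent deficient `B` has at least `3 (ρ(E) − 3)` units `(p, Y)`
(Units), `(B, p, Y) ↦ (Y ∪ p, p)` lands in the units of the independent boundary targets (CorankTwo's slack lemma),
and every unit has at most `3 (ρ(E) − 3)` claimants (Fibre).  **`thresholdIneq_four_top_of_nullity_four`**; with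
TopCore's climb on every matroid whose coloop-free core is simple of nullity `4` and rank `≥ 5`
(`thresholdIneq_four_top_of_core_nullity_four`), and at rank `5` the row `(3, 4)` on every simple coloop-free
rank-`5` matroid with `9` points (`profileIneqMinusQ_three_four_of_nullity_four`, `profileIneq_three_four_of_nullity_four`)
— the engine's whole `(9, 5)` catalogue.  Nothing open is asserted.
-/

open scoped Matroid

namespace PercRepro.Cogirth

open Finset ThmH Skew Shadow Profile

variable {α : Type} [DecidableEq α] {N : Matroid α} [N.Finite]

/-- An independent set (rank = size) is its own set of coloops. -/
theorem coloops_eq_self_of_rk_eq_card {S : Finset α} (hS : S ⊆ gr N) (h : rk N S = S.card) :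
    coloops N S = S := by
  ext x
  rw [mem_coloops]
  constructor
  · exact fun hx => hx.1
  · intro hx
    refine ⟨hx, fun hcl => ?_⟩
    rw [mem_clF_iff_rk_insert (hS hx) ((erase_subset x S).trans hS), insert_erase hx] at hcl
    have h1 := rk_le_card' (M := N) (S.erase x)
    rw [card_erase_of_mem hx] at h1
    have h2 : 1 ≤ S.card := card_pos.2 ⟨x, hx⟩
    omega

section Top

variable (hpair : ∀ x ∈ gr N, ∀ y ∈ gr N, x ≠ y → rk N {x, y} = 2)
  (hcf : ∀ z ∈ gr N, rk N ((gr N).erase z) = rk N (gr N)) (hn : (gr N).card = rk N (gr N) + 4)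
  (hR : 5 ≤ rk N (gr N))

include hpair hcf hn hR in
/-- **THE INDEPENDENT DEFICIENT SETS ARE PAID BY THE UNITS OF THE INDEPENDENT BOUNDARY TARGETS** (nullity `4`, simple,
coloop-free, `ρ(E) ≥ 5`): `#𝔅_ind ≤ Σ_{S boundary target, κ(S) = 4} #(coloops(S) ∩ cl(E ∖ S))`. -/
theorem card_indep_deficient_le_boundary_sum :
    ((Rq N 3).filter (fun B => rk N (gr N) - 1 + 1 ≤ rk N (gr N \ B) ∧
        (clF N B).card + rk N (gr N) = (gr N).card + 1 ∧ (coloops N B).card = 3)).card ≤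
    ∑ S ∈ ((levelSetCoQ N (rk N (gr N) - 1) 4).filter (fun S => rk N (gr N \ S) = rk N (gr N) - 1)).filter
        (fun S => ¬ (coloops N S).card ≤ 3),
      (coloops N S ∩ clF N (gr N \ S)).card := by
  set R := rk N (gr N) with hRdef
  set 𝔅 := (Rq N 3).filter (fun B => R - 1 + 1 ≤ rk N (gr N \ B) ∧
    (clF N B).card + R = (gr N).card + 1 ∧ (coloops N B).card = 3) with h𝔅def
  set Tb := ((levelSetCoQ N (R - 1) 4).filter (fun S => rk N (gr N \ S) = R - 1)).filter
    (fun S => ¬ (coloops N S).card ≤ 3) with hTbdef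
  -- the facts about an independent deficient set
  have hdef : ∀ B ∈ 𝔅, B ∈ Rq N 3 ∧ rk N (gr N \ B) = R ∧ (clF N B).card = 5 ∧ B.card = 3 := by
    intro B hB
    obtain ⟨hBq, hBt, hcl, hκ⟩ := mem_filter.1 hB
    have := rk_mono' (M := N) (sdiff_subset : gr N \ B ⊆ gr N)
    exact ⟨hBq, by omega, by omega, card_eq_three_of_card_coloops_eq_three hpair hBq hκ⟩
  -- the pairs (B, p, Y)
  set Pairs := 𝔅.sigma (fun B => (clF N B \ B).sigma (fun p =>
    ((gr N \ clF N B).powersetCard 3).filter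
      (fun Y => rk N (gr N \ Y) + 1 = R ∧ rk N (insert p Y) = 4))) with hPairsdef
  set Units := Tb.sigma (fun S => coloops N S ∩ clF N (gr N \ S)) with hUnitsdef
  let f : (Σ _ : Finset α, Σ _ : α, Finset α) → (Σ _ : Finset α, α) := fun x => ⟨insert x.2.1 x.2.2, x.2.1⟩
  -- (1) the unit count: 3 (R − 3) · #𝔅 ≤ #Pairs
  have hP : 3 * (R - 3) * 𝔅.card ≤ Pairs.card := by
    rw [hPairsdef, card_sigma]
    have : ∀ B ∈ 𝔅, 3 * (R - 3) ≤ ((clF N B \ B).sigma (fun p =>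
        ((gr N \ clF N B).powersetCard 3).filter
          (fun Y => rk N (gr N \ Y) + 1 = R ∧ rk N (insert p Y) = 4))).card := by
      intro B hB
      obtain ⟨hBq, hBsp, hcl, hB3⟩ := hdef B hB
      exact card_units_ge hpair hn hcf hBq hBsp hcl hB3 hR
    calc 3 * (R - 3) * 𝔅.card = ∑ _B ∈ 𝔅, 3 * (R - 3) := by rw [sum_const, smul_eq_mul, mul_comm]
      _ ≤ _ := sum_le_sum this
  -- (2) the map into the units
  have hfmem : ∀ x ∈ Pairs, f x ∈ Units := by
    rintro ⟨B, p, Y⟩ hx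
    obtain ⟨hB, hpY⟩ := mem_sigma.1 hx
    obtain ⟨hp, hY⟩ := mem_sigma.1 hpY
    simp only at hp hY
    obtain ⟨hBq, hBsp, hcl, hB3⟩ := hdef B hB
    obtain ⟨hpcl, hpB⟩ := mem_sdiff.1 hp
    obtain ⟨hYp, hYco, hS⟩ := mem_filter.1 hY
    obtain ⟨hYO, hYc⟩ := mem_powersetCard.1 hYp
    have hB' : B ∈ Rq N (4 - 1) := hBq
    have hYc' : Y.card = 4 - 1 := hYc
    have hSmem : insert p Y ∈ levelSetCoQ N (R - 1) 4 := insert_mem_levelSetCoQ_top hB' hYO hYco hpcl hpB hS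
    have hpunit : p ∈ coloops N (insert p Y) ∩ clF N (gr N \ insert p Y) :=
      mem_coloops_inter_clF_of_corank_two hB' hYO hYc' hpcl hpB hS (by norm_num)
    have hSb : rk N (gr N \ insert p Y) + 1 = R := rk_sdiff_insert_add_one hB' hYO hYco hpcl hpB
    have hSb' : rk N (gr N \ insert p Y) = R - 1 := by omega
    have hpY' : p ∉ Y := fun h => (mem_sdiff.1 (hYO h)).2 hpcl
    have hSg : insert p Y ⊆ gr N := insert_subset (clF_subset_gr B hpcl) (hYO.trans sdiff_subset)
    have hScard : (insert p Y).card = 4 := by rw [card_insert_of_notMem hpY', hYc]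
    have hκ : coloops N (insert p Y) = insert p Y :=
      coloops_eq_self_of_rk_eq_card hSg (by rw [hS, hScard])
    refine mem_sigma.2 ⟨mem_filter.2 ⟨mem_filter.2 ⟨hSmem, hSb'⟩, ?_⟩, hpunit⟩
    rw [hκ, hScard]
    norm_num
  have himg : Pairs.image f ⊆ Units := image_subset_iff.2 hfmem
  -- (3) the fibre bound
  have hfib : ∀ u ∈ Pairs.image f, (Pairs.filter (fun x => f x = u)).card ≤ 3 * (R - 3) := by
    intro u hu
    have hu' : u ∈ Units := himg hu
    obtain ⟨S, p⟩ := u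
    obtain ⟨hS, hp⟩ := mem_sigma.1 hu'
    simp only at hS hp
    obtain ⟨hSmem, hSb⟩ := mem_filter.1 (mem_filter.1 hS).1
    have hSg : S ⊆ gr N := (mem_levelSetCoQ.1 hSmem).1.1
    obtain ⟨hpco, hpcl⟩ := mem_inter.1 hp
    have hpS : p ∈ S := (mem_coloops.1 hpco).1
    have hp1 : rk N {p} = 1 := rk_singleton_eq_one_of_mem_coloops hSg hpco
    have hSb' : rk N (gr N \ S) + 1 = rk N (gr N) := by omega
    -- S has four points: it is insert p Y for a preimage
    have hS4 : S.card = 4 := by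
      obtain ⟨x, hxP, hfx⟩ := mem_image.1 hu
      obtain ⟨B, p', Y⟩ := x
      simp only [f, Sigma.mk.injEq] at hfx
      obtain ⟨hSeq, _⟩ := hfx
      obtain ⟨hB, hpY⟩ := mem_sigma.1 hxP
      obtain ⟨hp', hY⟩ := mem_sigma.1 hpY
      simp only at hp' hY
      obtain ⟨hYp, _, _⟩ := mem_filter.1 hY
      obtain ⟨hYO, hYc⟩ := mem_powersetCard.1 hYp
      have hp'Y : p' ∉ Y := fun h => (mem_sdiff.1 (hYO h)).2 (mem_sdiff.1 hp').1
      rw [← hSeq, card_insert_of_notMem hp'Y, hYc]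
    have hclaim := card_claimants_le_nullity_four hn hpair hR hSg hS4 hSb' hpS hp1 hpcl
    refine le_trans ?_ hclaim
    -- the fibre injects into the claimants via x ↦ x.1
    refine card_le_card_of_injOn (fun x => x.1) ?_ ?_
    · rintro ⟨B, p', Y⟩ hx
      obtain ⟨hxP, hfx⟩ := mem_filter.1 hx
      simp only [f, Sigma.mk.injEq] at hfx
      obtain ⟨hSeq, hpeq⟩ := hfx
      have hpeq' : p' = p := eq_of_heq hpeq
      subst hpeq'
      obtain ⟨hB, hpY⟩ := mem_sigma.1 hxP
      obtain ⟨hp', hY⟩ := mem_sigma.1 hpY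
      simp only at hp' hY
      obtain ⟨hBq, hBsp, hcl, hB3⟩ := hdef B hB
      obtain ⟨hp'cl, hp'B⟩ := mem_sdiff.1 hp'
      obtain ⟨hYp, _, _⟩ := mem_filter.1 hY
      obtain ⟨hYO, _⟩ := mem_powersetCard.1 hYp
      have hp'Y : p' ∉ Y := fun h => (mem_sdiff.1 (hYO h)).2 hp'cl
      refine mem_filter.2 ⟨hBq, hBsp, hcl, hB3, hp'cl, hp'B, ?_⟩
      rw [← hSeq, erase_insert hp'Y]
      ext w
      simp only [mem_inter, notMem_empty, iff_false, not_and]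
      intro hwcl hwY
      exact (mem_sdiff.1 (hYO hwY)).2 hwcl
    · rintro ⟨B₁, p₁, Y₁⟩ hx₁ ⟨B₂, p₂, Y₂⟩ hx₂ heq
      simp only at heq
      obtain ⟨hxP₁, hfx₁⟩ := mem_filter.1 hx₁
      obtain ⟨hxP₂, hfx₂⟩ := mem_filter.1 hx₂
      simp only [f, Sigma.mk.injEq] at hfx₁ hfx₂
      obtain ⟨hS₁, hp₁⟩ := hfx₁
      obtain ⟨hS₂, hp₂⟩ := hfx₂
      have hp12 : p₁ = p₂ := (eq_of_heq hp₁).trans (eq_of_heq hp₂).symm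
      have hpY₁ : p₁ ∉ Y₁ := by
        obtain ⟨_, hpY⟩ := mem_sigma.1 hxP₁
        obtain ⟨hp', hY⟩ := mem_sigma.1 hpY
        simp only at hp' hY
        intro h
        exact (mem_sdiff.1 ((mem_powersetCard.1 (mem_filter.1 hY).1).1 h)).2 (mem_sdiff.1 hp').1
      have hpY₂ : p₂ ∉ Y₂ := by
        obtain ⟨_, hpY⟩ := mem_sigma.1 hxP₂
        obtain ⟨hp', hY⟩ := mem_sigma.1 hpY
        simp only at hp' hY
        intro h
        exact (mem_sdiff.1 ((mem_powersetCard.1 (mem_filter.1 hY).1).1 h)).2 (mem_sdiff.1 hp').1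
      have hY : Y₁ = Y₂ := by
        have h : (insert p₁ Y₁).erase p₂ = (insert p₂ Y₂).erase p₂ := by rw [hS₁.trans hS₂.symm]
        rw [← hp12, erase_insert hpY₁, hp12, erase_insert hpY₂] at h
        exact h
      rw [heq, hp12, hY]
  -- (4) assemble
  have hPU : Pairs.card ≤ 3 * (R - 3) * Units.card :=
    (card_le_mul_card_image Pairs _ hfib).trans (Nat.mul_le_mul_left _ (card_le_card himg))
  have hpos : 1 ≤ 3 * (R - 3) := by omega
  have hBU : 𝔅.card ≤ Units.card := by
    by_contra hlt
    have : 3 * (R - 3) * Units.card < 3 * (R - 3) * 𝔅.card :=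
      Nat.mul_lt_mul_of_pos_left (by omega) hpos
    omega
  rw [hUnitsdef, card_sigma] at hBU
  exact hBU

include hpair hcf hn hR in
/-- **THE TOP THRESHOLD AT NULLITY `4` WITHOUT A `6`-POINT PLANE** (simple, coloop-free, `ρ(E) ≥ 5`):
`ThresholdIneq N 4 (ρ(E) − 1)`. -/
theorem thresholdIneq_four_top_of_nullity_four_of_no_six
    (hno : ∀ B ∈ Rq N 3, (clF N B).card + rk N (gr N) ≠ (gr N).card + 2) :
    ThresholdIneq N 4 (rk N (gr N) - 1) := by
  rw [thresholdIneq_iff_excess_boundary (by norm_num)]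
  set R := rk N (gr N) with hRdef
  set L := (Rq N (4 - 1)).filter (fun B => R - 1 + 1 ≤ rk N (gr N \ B)) with hLdef
  set T := levelSetCoQ N (R - 1) 4 with hTdef
  have hL : ∀ B ∈ L, B ∈ Rq N 3 ∧ rk N (gr N \ B) = R ∧ (clF N B).card ≤ 5 := by
    intro B hB
    obtain ⟨hBq, hBt⟩ := mem_filter.1 hB
    have hBq' : B ∈ Rq N 3 := hBq
    have hmono := rk_mono' (M := N) (sdiff_subset : gr N \ B ⊆ gr N)
    have hBsp : rk N (gr N \ B) = R := by omega
    have h := rk_sdiff_le_card_sdiff_clF_add_of_coloopFree (q := 4) (by norm_num) hcf hBq' (by omega)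
    have h1 := card_sdiff_add_card_eq_card (clF_subset_gr (M := N) B)
    have hne := hno B hBq'
    exact ⟨hBq', hBsp, by omega⟩
  -- the left side is R · #L; the first right sum plus the deficient count dominates it
  have hleft : ∑ B ∈ L, rk N (gr N \ B) = ∑ _B ∈ L, R := sum_congr rfl (fun B hB => (hL B hB).2.1)
  have hright : ∑ _B ∈ L, R ≤ ∑ B ∈ L, (gr N \ clF N B).card + (L.filter (fun B => (clF N B).card = 5)).card := by
    rw [card_filter, ← sum_add_distrib]
    refine sum_le_sum (fun B hB => ?_)
    obtain ⟨_, _, hcl⟩ := hL B hB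
    have := card_sdiff_add_card_eq_card (clF_subset_gr (M := N) B)
    split_ifs with h5 <;> omega
  -- the deficient sets split into dependent (≤ 2 coloops) and independent (3 coloops)
  set 𝔇 := (Rq N 3).filter (fun B => R - 1 + 1 ≤ rk N (gr N \ B) ∧
    (clF N B).card + R = (gr N).card + 1 ∧ (coloops N B).card ≤ 2) with h𝔇def
  set 𝔅 := (Rq N 3).filter (fun B => R - 1 + 1 ≤ rk N (gr N \ B) ∧
    (clF N B).card + R = (gr N).card + 1 ∧ (coloops N B).card = 3) with h𝔅def
  have hsplit : (L.filter (fun B => (clF N B).card = 5)).card ≤ 𝔇.card + 𝔅.card := by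
    refine (card_le_card ?_).trans (card_union_le 𝔇 𝔅)
    intro B hB
    obtain ⟨hBL, hcl⟩ := mem_filter.1 hB
    obtain ⟨hBq, hBt⟩ := mem_filter.1 hBL
    have hBq' : B ∈ Rq N 3 := hBq
    have hκ : (coloops N B).card ≤ 3 := by
      have h := card_coloops_le_rk (mem_Rq.1 hBq').1
      have h3 : rk N B = 3 := rk_eq_of_eRk_eq (mem_Rq.1 hBq').2
      omega
    rw [mem_union]
    by_cases h2 : (coloops N B).card ≤ 2
    · exact Or.inl (mem_filter.2 ⟨hBq', hBt, by omega, h2⟩)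
    · exact Or.inr (mem_filter.2 ⟨hBq', hBt, by omega, by omega⟩)
  -- the dependent deficient sets: DependentPay
  have hdep : 𝔇.card ≤ ∑ S ∈ T.filter (fun S => (coloops N S).card ≤ 3),
      (4 - ((coloops N S).filter
        (fun y => S.erase y ∈ (Rq N (4 - 1)).filter (fun B => R - 1 + 1 ≤ rk N (gr N \ B)))).card) :=
    card_dependent_deficient_le (by omega)
  -- the independent deficient sets: the three countings
  have hind : 𝔅.card ≤ ∑ S ∈ (T.filter (fun S => rk N (gr N \ S) = R - 1)).filter
      (fun S => ¬ (coloops N S).card ≤ 3), (coloops N S ∩ clF N (gr N \ S)).card :=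
    card_indep_deficient_le_boundary_sum hpair hcf hn hR
  -- the boundary units of the independent targets are their slack
  have hbd : ∑ S ∈ (T.filter (fun S => rk N (gr N \ S) = R - 1)).filter (fun S => ¬ (coloops N S).card ≤ 3),
      (coloops N S ∩ clF N (gr N \ S)).card ≤
      ∑ S ∈ T.filter (fun S => ¬ (coloops N S).card ≤ 3),
        (4 - ((coloops N S).filter
          (fun y => S.erase y ∈ (Rq N (4 - 1)).filter (fun B => R - 1 + 1 ≤ rk N (gr N \ B)))).card) := by
    have hsub : (T.filter (fun S => rk N (gr N \ S) = R - 1)).filter (fun S => ¬ (coloops N S).card ≤ 3) ⊆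
        T.filter (fun S => ¬ (coloops N S).card ≤ 3) := by
      intro S hS
      obtain ⟨hS1, hS2⟩ := mem_filter.1 hS
      exact mem_filter.2 ⟨(mem_filter.1 hS1).1, hS2⟩
    refine (sum_le_sum (fun S hS => ?_)).trans (sum_le_sum_of_subset_of_nonneg hsub (fun _ _ _ => Nat.zero_le _))
    obtain ⟨hS1, hS2⟩ := mem_filter.1 hS
    obtain ⟨hST, hSb⟩ := mem_filter.1 hS1
    have hSg : S ⊆ gr N := (mem_levelSetCoQ.1 hST).1.1
    have hSrk : rk N S = 4 := rk_eq_of_eRk_eq_cq (mem_levelSetCoQ.1 hST).1.2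
    have hκ4 : (coloops N S).card = 4 := by
      have := card_coloops_le_rk hSg
      omega
    rw [filter_coloops_eq_of_eq hST (by norm_num) hSb]
    have := card_sdiff_add_card_inter (coloops N S) (clF N (gr N \ S))
    omega
  -- the two target families together are all of T; the slack identity
  have hsum : ∑ S ∈ T.filter (fun S => (coloops N S).card ≤ 3),
      (4 - ((coloops N S).filter
        (fun y => S.erase y ∈ (Rq N (4 - 1)).filter (fun B => R - 1 + 1 ≤ rk N (gr N \ B)))).card) +
      ∑ S ∈ T.filter (fun S => ¬ (coloops N S).card ≤ 3),
      (4 - ((coloops N S).filter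
        (fun y => S.erase y ∈ (Rq N (4 - 1)).filter (fun B => R - 1 + 1 ≤ rk N (gr N \ B)))).card) =
      ∑ S ∈ T, (4 - ((coloops N S).filter
        (fun y => S.erase y ∈ (Rq N (4 - 1)).filter (fun B => R - 1 + 1 ≤ rk N (gr N \ B)))).card) :=
    sum_filter_add_sum_filter_not _ _ _
  have hslack : ∑ S ∈ T, (4 - ((coloops N S).filter
        (fun y => S.erase y ∈ (Rq N (4 - 1)).filter (fun B => R - 1 + 1 ≤ rk N (gr N \ B)))).card) =
      ∑ S ∈ T, (4 - (coloops N S).card) +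
        ∑ S ∈ T.filter (fun S => rk N (gr N \ S) = R - 1), (coloops N S ∩ clF N (gr N \ S)).card :=
    sum_slack_eq_add_boundary N 4 (R - 1) (by norm_num)
  rw [hleft]
  omega

end Top

/-- **THE TOP THRESHOLD OF THE CO-RANK-`4` FAMILY HOLDS ON EVERY SIMPLE COLOOP-FREE MATROID OF NULLITY `4` AND RANK
`≥ 5`**: `#E = ρ(E) + 4` gives `ThresholdIneq N 4 (ρ(E) − 1)` — a `6`-point plane by TopNuTwo, otherwise by the
countings above. -/
theorem thresholdIneq_four_top_of_nullity_four (hpair : ∀ x ∈ gr N, ∀ y ∈ gr N, x ≠ y → rk N {x, y} = 2)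
    (hcf : ∀ z ∈ gr N, rk N ((gr N).erase z) = rk N (gr N)) (hn : (gr N).card = rk N (gr N) + 4)
    (hR : 5 ≤ rk N (gr N)) : ThresholdIneq N 4 (rk N (gr N) - 1) := by
  by_cases hex : ∃ B ∈ Rq N 3, (clF N B).card + rk N (gr N) = (gr N).card + 2
  · obtain ⟨B, hB, hl⟩ := hex
    exact thresholdIneq_four_top_of_long_plane hcf hB hl (by omega)
  · exact thresholdIneq_four_top_of_nullity_four_of_no_six hpair hcf hn hR
      (fun B hB heq => hex ⟨B, hB, heq⟩)

/-- **The nullity-`4` theorem on every matroid whose core qualifies**: `W ⊆ E` a finset of coloops and loops of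
`N`, the core `N ∖ W` simple, coloop-free, of rank `≥ 5` with `#(E ∖ W) = ρ(N ∖ W) + 4`. -/
theorem thresholdIneq_four_top_of_core_nullity_four {W : Finset α} (hW : W ⊆ gr N)
    (hcl : ∀ z ∈ W, rk N ((gr N).erase z) + 1 = rk N (gr N) ∨ rk N {z} = 0)
    (hpair : ∀ x ∈ gr (N ＼ (W : Set α)), ∀ y ∈ gr (N ＼ (W : Set α)), x ≠ y →
      rk (N ＼ (W : Set α)) {x, y} = 2)
    (hcf : ∀ z ∈ gr (N ＼ (W : Set α)), rk (N ＼ (W : Set α)) ((gr (N ＼ (W : Set α))).erase z) =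
      rk (N ＼ (W : Set α)) (gr (N ＼ (W : Set α))))
    (hn : (gr (N ＼ (W : Set α))).card = rk (N ＼ (W : Set α)) (gr (N ＼ (W : Set α))) + 4)
    (hR : 5 ≤ rk (N ＼ (W : Set α)) (gr (N ＼ (W : Set α)))) : ThresholdIneq N 4 (rk N (gr N) - 1) :=
  thresholdIneq_top_of_delete_core (by norm_num) W N hW hcl (by omega)
    (thresholdIneq_four_top_of_nullity_four hpair hcf hn hR)

/-- **THE ROW `(3, 4)` OF `Π⁻` ON EVERY SIMPLE COLOOP-FREE RANK-`5` MATROID WITH `9` POINTS**: the top threshold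
`t = 4` is `(I_4) ⟺ (I_3)`, the row. -/
theorem profileIneqMinusQ_three_four_of_nullity_four
    (hpair : ∀ x ∈ gr N, ∀ y ∈ gr N, x ≠ y → rk N {x, y} = 2)
    (hcf : ∀ z ∈ gr N, rk N ((gr N).erase z) = rk N (gr N))
    (hR : rk N (gr N) = 5) (hn : (gr N).card = 9) : ProfileIneqMinusQ N 3 4 := by
  have h := thresholdIneq_four_top_of_nullity_four hpair hcf (by omega) (by omega)
  rw [hR] at h
  have h' : ThresholdIneq N 4 (4 - 1) := (thresholdIneq_pred_iff (by norm_num)).2 h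
  exact (thresholdIneq_iff_row (by norm_num)).1 h'

/-- **THE ROW `(Π_{3,4})` ON EVERY SIMPLE COLOOP-FREE RANK-`5` MATROID WITH `9` POINTS.** -/
theorem profileIneq_three_four_of_nullity_four
    (hpair : ∀ x ∈ gr N, ∀ y ∈ gr N, x ≠ y → rk N {x, y} = 2)
    (hcf : ∀ z ∈ gr N, rk N ((gr N).erase z) = rk N (gr N))
    (hR : rk N (gr N) = 5) (hn : (gr N).card = 9) : ProfileIneq N 3 4 :=
  profileIneq_of_minusQ (by norm_num) (profileIneqMinusQ_three_four_of_nullity_four hpair hcf hR hn)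

end PercRepro.Cogirth
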